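import Mathlib
import HarnessLib
import Literature.Computability.AlgebraicComplexity.ArithCircuit
import Literature.Computability.AlgebraicComplexity.ArithCircuitProofs
import Literature.Computability.AlgebraicComplexity.SupportSymmetrisation
import Summits.ValiantsHypothesis.ValiantsHypothesis.Theorems.MonotoneRestorationMonotoneRestorationQPRowScanAppend

/-!
# ValiantsHypothesis / MonotoneRestoration — `MonotoneRestorationQP`, line `Sketch`, stub D4 (2/3)

Support file for crux item `stmt-ValiantsHypothesis-15886`
(`Summit.ValiantsHypothesis.ValiantsHypothesis.Theses.MonotoneRestoration.MonotoneRestorationQP`),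
line `Sketch`, stub `stub_rowScan_program` (Theorem δ, the GLOBAL BLOCK of the scan program): the
three blocks of invariant gates (support `∅`) appended after the row blocks.

* `rowScanProg_blockP`: the power-sum matrices `P_{k+1} = Σ_i A_i^{k+1}` — one sum gate per
  entry, reading the row-block gates holding the entries of `A_i^{k+1}`; the value is invariant
  under all diagonal renamings because renaming by `σ` carries `A_i` to `A_{σ i}`
  (`rowScanProg_rename_pow_apply`, `rowScanProg_psum_invariant`).
* `rowScanProg_blockE0`, `rowScanProg_blockEstep`, `rowScanProg_blockE`: the entries of a
  solution `E` of Newton's recursion `E_m = Σ_{i<m} Σ_c ((-1)^i / m) (E_{m-1-i})_{ac} (P_{i+1})_{cb}`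
  — product gates of two support-`∅` gates and weighted sum gates, by induction on `m`.

Everything is phrased with the admissibility conjunction and the "provided at an index `≥ l₀`"
idiom of the companion file `…QPRowScanAppend.lean`; `E` and the `P`'s are abstract matrix
families here (the recursion is a hypothesis), instantiated in `…QPRowScanProgram.lean`.
-/

-- `Summit.ValiantsHypothesis.ValiantsHypothesis.…` is the tree's mandated single-conjunct layout
-- (Sub = Summit), so the duplicated namespace component is intended.
set_option linter.dupNamespace false

noncomputable section

namespace Summit.ValiantsHypothesis.ValiantsHypothesis.Theorems

open Literature.Computability.AlgebraicComplexity

/-! ### Invariance of the power-sum matrices -/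

/-- Renaming by the diagonal action of `σ` carries (the entries of the powers of) the transfer
matrix of row `j`, `A_j = (H_{ab}(p_1(r_j), …, p_D(r_j)))_{ab}` with `p_d(r_j) = Σ_{j'} x_{j j'}^d`,
to those of row `σ j`. [folklore] -/
theorem rowScanProg_rename_pow_apply {n w D : ℕ} (H : Fin w → Fin w → MvPolynomial (Fin D) ℂ)
    (σ : Equiv.Perm (Fin n)) (j : Fin n) (m : ℕ) (a b : Fin w) :
    MvPolynomial.rename (fun pq : Fin n × Fin n => (σ pq.1, σ pq.2))
      (((Matrix.of fun a' b' : Fin w => MvPolynomial.aeval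
          (fun d : Fin D => ∑ j' : Fin n,
            (MvPolynomial.X (j, j') : MvPolynomial (Fin n × Fin n) ℂ) ^ ((d : ℕ) + 1))
          (H a' b')) ^ m) a b) =
      ((Matrix.of fun a' b' : Fin w => MvPolynomial.aeval
          (fun d : Fin D => ∑ j' : Fin n,
            (MvPolynomial.X (σ j, j') : MvPolynomial (Fin n × Fin n) ℂ) ^ ((d : ℕ) + 1))
          (H a' b')) ^ m) a b := by
  set f : MvPolynomial (Fin n × Fin n) ℂ →ₐ[ℂ] MvPolynomial (Fin n × Fin n) ℂ :=
    MvPolynomial.rename (fun pq : Fin n × Fin n => (σ pq.1, σ pq.2)) with hf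
  set A₁ : Matrix (Fin w) (Fin w) (MvPolynomial (Fin n × Fin n) ℂ) :=
    Matrix.of fun a' b' : Fin w => MvPolynomial.aeval (fun d : Fin D => ∑ j' : Fin n,
      (MvPolynomial.X (j, j') : MvPolynomial (Fin n × Fin n) ℂ) ^ ((d : ℕ) + 1)) (H a' b')
    with hA₁
  set A₂ : Matrix (Fin w) (Fin w) (MvPolynomial (Fin n × Fin n) ℂ) :=
    Matrix.of fun a' b' : Fin w => MvPolynomial.aeval (fun d : Fin D => ∑ j' : Fin n,
      (MvPolynomial.X (σ j, j') : MvPolynomial (Fin n × Fin n) ℂ) ^ ((d : ℕ) + 1)) (H a' b')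
    with hA₂
  have key : f ((A₁ ^ m) a b) = ((A₁.map f) ^ m) a b := by
    rw [← AlgHom.mapMatrix_apply, ← map_pow f.mapMatrix A₁ m, AlgHom.mapMatrix_apply,
      Matrix.map_apply]
  suffices hM : A₁.map f = A₂ by rw [key, hM]
  refine Matrix.ext fun a' b' => ?_
  rw [Matrix.map_apply, hA₁, hA₂, Matrix.of_apply, Matrix.of_apply, ← AlgHom.comp_apply,
    MvPolynomial.comp_aeval]
  refine congrArg (fun F : Fin D → MvPolynomial (Fin n × Fin n) ℂ =>
    MvPolynomial.aeval F (H a' b')) (funext fun d => ?_)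
  simp only [hf, map_sum, map_pow, MvPolynomial.rename_X]
  exact Equiv.sum_comp σ (fun j' => (MvPolynomial.X (σ j, j') :
    MvPolynomial (Fin n × Fin n) ℂ) ^ ((d : ℕ) + 1))

/-- The entries of the power-sum matrices `Σ_j A_j^m` are invariant under ALL diagonal
renamings (reindex the sum over the rows by `σ`). [folklore] -/
theorem rowScanProg_psum_invariant {n w D : ℕ} (H : Fin w → Fin w → MvPolynomial (Fin D) ℂ)
    (σ : Equiv.Perm (Fin n)) (m : ℕ) (a b : Fin w) :
    MvPolynomial.rename (fun pq : Fin n × Fin n => (σ pq.1, σ pq.2))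
      (∑ j : Fin n, ((Matrix.of fun a' b' : Fin w => MvPolynomial.aeval
          (fun d : Fin D => ∑ j' : Fin n,
            (MvPolynomial.X (j, j') : MvPolynomial (Fin n × Fin n) ℂ) ^ ((d : ℕ) + 1))
          (H a' b')) ^ m) a b) =
      ∑ j : Fin n, ((Matrix.of fun a' b' : Fin w => MvPolynomial.aeval
          (fun d : Fin D => ∑ j' : Fin n,
            (MvPolynomial.X (j, j') : MvPolynomial (Fin n × Fin n) ℂ) ^ ((d : ℕ) + 1))
          (H a' b')) ^ m) a b := by
  rw [map_sum]
  simp_rw [rowScanProg_rename_pow_apply]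
  exact Equiv.sum_comp σ (fun j => ((Matrix.of fun a' b' : Fin w => MvPolynomial.aeval
    (fun d : Fin D => ∑ j' : Fin n,
      (MvPolynomial.X (j, j') : MvPolynomial (Fin n × Fin n) ℂ) ^ ((d : ℕ) + 1)) (H a' b')) ^ m) a b)

/-! ### Composing one-gate steps (concrete form) -/

/-- `rowScanProg_provide_family` for admissible annotated gate lists and values provided at an
index `≥ l₀`: if from every admissible extension of `G` one more gate provides `v e`, then some
admissible extension by at most `#κ` gates provides all the `v e`. [folklore] -/
theorem rowScanProg_provide_all {n : ℕ} (K' : ℕ → Finset (Fin n)) (B l₀ : ℕ) {κ : Type*}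
    [Fintype κ] (v : κ → MvPolynomial (Fin n × Fin n) ℂ)
    (G : List (ArithCircuit.Gate ℂ (Fin n × Fin n)))
    (hG : (∀ g ∈ G, g.args ≠ []) ∧ (∀ g ∈ G, g.fanIn ≤ B) ∧
        (∀ (i : ℕ) (g : ArithCircuit.Gate ℂ (Fin n × Fin n)), G[i]? = some g →
          ∀ u ∈ g.args, u.RefsBelow i) ∧
        (∀ (i : ℕ) (us : List (ArithCircuit.Operand ℂ (Fin n × Fin n))),
          G[i]? = some (.prod us) → ∀ u ∈ us, SupportSymm.osupp K' u ⊆ K' i) ∧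
        (∀ (i : ℕ) (σ : Equiv.Perm (Fin n)), i < G.length → (∀ x ∈ K' i, σ x = x) →
          MvPolynomial.rename (fun pq : Fin n × Fin n => (σ pq.1, σ pq.2))
            ((ArithCircuit.gateValues G).getD i 0) = (ArithCircuit.gateValues G).getD i 0))
    (hstep : ∀ G₁ : List (ArithCircuit.Gate ℂ (Fin n × Fin n)), G <+: G₁ →
      ((∀ g ∈ G₁, g.args ≠ []) ∧ (∀ g ∈ G₁, g.fanIn ≤ B) ∧
        (∀ (i : ℕ) (g : ArithCircuit.Gate ℂ (Fin n × Fin n)), G₁[i]? = some g →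
          ∀ u ∈ g.args, u.RefsBelow i) ∧
        (∀ (i : ℕ) (us : List (ArithCircuit.Operand ℂ (Fin n × Fin n))),
          G₁[i]? = some (.prod us) → ∀ u ∈ us, SupportSymm.osupp K' u ⊆ K' i) ∧
        (∀ (i : ℕ) (σ : Equiv.Perm (Fin n)), i < G₁.length → (∀ x ∈ K' i, σ x = x) →
          MvPolynomial.rename (fun pq : Fin n × Fin n => (σ pq.1, σ pq.2))
            ((ArithCircuit.gateValues G₁).getD i 0) = (ArithCircuit.gateValues G₁).getD i 0)) →
      ∀ e : κ, ∃ G₂ : List (ArithCircuit.Gate ℂ (Fin n × Fin n)), G₁ <+: G₂ ∧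
        ((∀ g ∈ G₂, g.args ≠ []) ∧ (∀ g ∈ G₂, g.fanIn ≤ B) ∧
        (∀ (i : ℕ) (g : ArithCircuit.Gate ℂ (Fin n × Fin n)), G₂[i]? = some g →
          ∀ u ∈ g.args, u.RefsBelow i) ∧
        (∀ (i : ℕ) (us : List (ArithCircuit.Operand ℂ (Fin n × Fin n))),
          G₂[i]? = some (.prod us) → ∀ u ∈ us, SupportSymm.osupp K' u ⊆ K' i) ∧
        (∀ (i : ℕ) (σ : Equiv.Perm (Fin n)), i < G₂.length → (∀ x ∈ K' i, σ x = x) →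
          MvPolynomial.rename (fun pq : Fin n × Fin n => (σ pq.1, σ pq.2))
            ((ArithCircuit.gateValues G₂).getD i 0) = (ArithCircuit.gateValues G₂).getD i 0)) ∧
        G₂.length = G₁.length + 1 ∧
        ∃ j, l₀ ≤ j ∧ j < G₂.length ∧ (ArithCircuit.gateValues G₂).getD j 0 = v e) :
    ∃ G' : List (ArithCircuit.Gate ℂ (Fin n × Fin n)), G <+: G' ∧
      ((∀ g ∈ G', g.args ≠ []) ∧ (∀ g ∈ G', g.fanIn ≤ B) ∧
        (∀ (i : ℕ) (g : ArithCircuit.Gate ℂ (Fin n × Fin n)), G'[i]? = some g →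
          ∀ u ∈ g.args, u.RefsBelow i) ∧
        (∀ (i : ℕ) (us : List (ArithCircuit.Operand ℂ (Fin n × Fin n))),
          G'[i]? = some (.prod us) → ∀ u ∈ us, SupportSymm.osupp K' u ⊆ K' i) ∧
        (∀ (i : ℕ) (σ : Equiv.Perm (Fin n)), i < G'.length → (∀ x ∈ K' i, σ x = x) →
          MvPolynomial.rename (fun pq : Fin n × Fin n => (σ pq.1, σ pq.2))
            ((ArithCircuit.gateValues G').getD i 0) = (ArithCircuit.gateValues G').getD i 0)) ∧
      G'.length ≤ G.length + Fintype.card κ ∧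
      ∀ e, ∃ j, l₀ ≤ j ∧ j < G'.length ∧ (ArithCircuit.gateValues G').getD j 0 = v e :=
  rowScanProg_provide_family
    (fun G₀ => (∀ g ∈ G₀, g.args ≠ []) ∧ (∀ g ∈ G₀, g.fanIn ≤ B) ∧
        (∀ (i : ℕ) (g : ArithCircuit.Gate ℂ (Fin n × Fin n)), G₀[i]? = some g →
          ∀ u ∈ g.args, u.RefsBelow i) ∧
        (∀ (i : ℕ) (us : List (ArithCircuit.Operand ℂ (Fin n × Fin n))),
          G₀[i]? = some (.prod us) → ∀ u ∈ us, SupportSymm.osupp K' u ⊆ K' i) ∧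
        (∀ (i : ℕ) (σ : Equiv.Perm (Fin n)), i < G₀.length → (∀ x ∈ K' i, σ x = x) →
          MvPolynomial.rename (fun pq : Fin n × Fin n => (σ pq.1, σ pq.2))
            ((ArithCircuit.gateValues G₀).getD i 0) = (ArithCircuit.gateValues G₀).getD i 0))
    (fun G₀ e => ∃ j, l₀ ≤ j ∧ j < G₀.length ∧
      (ArithCircuit.gateValues G₀).getD j 0 = v e)
    (fun _ _ _ h he => rowScanProg_prov_mono h he) G hG hstep

/-! ### Block 1: the power-sum matrices -/

/-- **The power-sum block.** For every `k < n` and entry `(a, b)`, one sum gate of fan-in `n + 1`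
reading the row-block gates `idx i k a b` (values `(A_i^{k+1})_{ab}`) provides
`(Σ_i A_i^{k+1})_{ab}` at support `∅`; admissible since this value is invariant under all
diagonal renamings (`hA`). [folklore] -/
theorem rowScanProg_blockP {n w : ℕ} (K' : ℕ → Finset (Fin n)) (B : ℕ) (hB : n + 1 ≤ B)
    (A : Fin n → Matrix (Fin w) (Fin w) (MvPolynomial (Fin n × Fin n) ℂ))
    (hA : ∀ (σ : Equiv.Perm (Fin n)) (m : ℕ) (a b : Fin w),
      MvPolynomial.rename (fun pq : Fin n × Fin n => (σ pq.1, σ pq.2)) (∑ j, (A j ^ m) a b) =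
        ∑ j, (A j ^ m) a b)
    (L : List (ArithCircuit.Gate ℂ (Fin n × Fin n)))
    (idx : Fin n → Fin n → Fin w → Fin w → ℕ)
    (hidx : ∀ (i k : Fin n) (a b : Fin w), idx i k a b < L.length ∧
      (ArithCircuit.gateValues L).getD (idx i k a b) 0 = (A i ^ ((k : ℕ) + 1)) a b)
    (G : List (ArithCircuit.Gate ℂ (Fin n × Fin n))) (hLG : L <+: G)
    (hG : (∀ g ∈ G, g.args ≠ []) ∧ (∀ g ∈ G, g.fanIn ≤ B) ∧
      (∀ (i : ℕ) (g : ArithCircuit.Gate ℂ (Fin n × Fin n)), G[i]? = some g →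
        ∀ u ∈ g.args, u.RefsBelow i) ∧
      (∀ (i : ℕ) (us : List (ArithCircuit.Operand ℂ (Fin n × Fin n))),
        G[i]? = some (.prod us) → ∀ u ∈ us, SupportSymm.osupp K' u ⊆ K' i) ∧
      (∀ (i : ℕ) (σ : Equiv.Perm (Fin n)), i < G.length → (∀ x ∈ K' i, σ x = x) →
        MvPolynomial.rename (fun pq : Fin n × Fin n => (σ pq.1, σ pq.2))
          ((ArithCircuit.gateValues G).getD i 0) = (ArithCircuit.gateValues G).getD i 0)) :
    ∃ G' : List (ArithCircuit.Gate ℂ (Fin n × Fin n)), G <+: G' ∧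
      ((∀ g ∈ G', g.args ≠ []) ∧ (∀ g ∈ G', g.fanIn ≤ B) ∧
        (∀ (i : ℕ) (g : ArithCircuit.Gate ℂ (Fin n × Fin n)), G'[i]? = some g →
          ∀ u ∈ g.args, u.RefsBelow i) ∧
        (∀ (i : ℕ) (us : List (ArithCircuit.Operand ℂ (Fin n × Fin n))),
          G'[i]? = some (.prod us) → ∀ u ∈ us, SupportSymm.osupp K' u ⊆ K' i) ∧
        (∀ (i : ℕ) (σ : Equiv.Perm (Fin n)), i < G'.length → (∀ x ∈ K' i, σ x = x) →
          MvPolynomial.rename (fun pq : Fin n × Fin n => (σ pq.1, σ pq.2))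
            ((ArithCircuit.gateValues G').getD i 0) = (ArithCircuit.gateValues G').getD i 0)) ∧
      G'.length ≤ G.length + Fintype.card (Fin n × Fin w × Fin w) ∧
      ∀ e : Fin n × Fin w × Fin w, ∃ j, L.length ≤ j ∧ j < G'.length ∧
        (ArithCircuit.gateValues G').getD j 0 = (∑ i, A i ^ ((e.1 : ℕ) + 1)) e.2.1 e.2.2 := by
  refine rowScanProg_provide_all K' B L.length _ G hG ?_
  rintro G₁ hGG₁ hG₁ ⟨k, a, b⟩
  obtain ⟨M, hM⟩ := hLG.trans hGG₁
  have hlen : L.length ≤ G₁.length := (hLG.trans hGG₁).length_le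
  have hS : ∑ i, (1 : ℂ) • (ArithCircuit.gateValues G₁).getD (idx i k a b) 0 =
      (∑ i, A i ^ ((k : ℕ) + 1)) a b := by
    rw [Matrix.sum_apply]
    refine Finset.sum_congr rfl fun i _ => ?_
    rw [one_smul, ← hM, rowScanProg_getD_append L M (hidx i k a b).1, (hidx i k a b).2]
  have h := rowScanProg_provide_sum K' B L.length (ι := Fin n) (by simpa using hB) (fun _ => 1)
    (fun i => idx i k a b) G₁ hlen hG₁ (fun i => (hidx i k a b).1.trans_le hlen)
    (fun σ => by rw [hS, Matrix.sum_apply]; exact hA σ _ a b)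
  rwa [hS] at h

/-! ### Block 2: Newton's recursion -/

/-- **The identity matrix `E_0 = 1`.** One constant gate per entry. [folklore] -/
theorem rowScanProg_blockE0 {n w : ℕ} (K' : ℕ → Finset (Fin n)) (B l₀ : ℕ) (hB : 1 ≤ B)
    (G : List (ArithCircuit.Gate ℂ (Fin n × Fin n))) (hl : l₀ ≤ G.length)
    (hG : (∀ g ∈ G, g.args ≠ []) ∧ (∀ g ∈ G, g.fanIn ≤ B) ∧
      (∀ (i : ℕ) (g : ArithCircuit.Gate ℂ (Fin n × Fin n)), G[i]? = some g →
        ∀ u ∈ g.args, u.RefsBelow i) ∧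
      (∀ (i : ℕ) (us : List (ArithCircuit.Operand ℂ (Fin n × Fin n))),
        G[i]? = some (.prod us) → ∀ u ∈ us, SupportSymm.osupp K' u ⊆ K' i) ∧
      (∀ (i : ℕ) (σ : Equiv.Perm (Fin n)), i < G.length → (∀ x ∈ K' i, σ x = x) →
        MvPolynomial.rename (fun pq : Fin n × Fin n => (σ pq.1, σ pq.2))
          ((ArithCircuit.gateValues G).getD i 0) = (ArithCircuit.gateValues G).getD i 0)) :
    ∃ G' : List (ArithCircuit.Gate ℂ (Fin n × Fin n)), G <+: G' ∧
      ((∀ g ∈ G', g.args ≠ []) ∧ (∀ g ∈ G', g.fanIn ≤ B) ∧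
        (∀ (i : ℕ) (g : ArithCircuit.Gate ℂ (Fin n × Fin n)), G'[i]? = some g →
          ∀ u ∈ g.args, u.RefsBelow i) ∧
        (∀ (i : ℕ) (us : List (ArithCircuit.Operand ℂ (Fin n × Fin n))),
          G'[i]? = some (.prod us) → ∀ u ∈ us, SupportSymm.osupp K' u ⊆ K' i) ∧
        (∀ (i : ℕ) (σ : Equiv.Perm (Fin n)), i < G'.length → (∀ x ∈ K' i, σ x = x) →
          MvPolynomial.rename (fun pq : Fin n × Fin n => (σ pq.1, σ pq.2))
            ((ArithCircuit.gateValues G').getD i 0) = (ArithCircuit.gateValues G').getD i 0)) ∧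
      G'.length ≤ G.length + Fintype.card (Fin w × Fin w) ∧
      ∀ e : Fin w × Fin w, ∃ j, l₀ ≤ j ∧ j < G'.length ∧
        (ArithCircuit.gateValues G').getD j 0 =
          (1 : Matrix (Fin w) (Fin w) (MvPolynomial (Fin n × Fin n) ℂ)) e.1 e.2 := by
  refine rowScanProg_provide_all K' B l₀ _ G hG ?_
  intro G₁ hGG₁ hG₁ e
  have h := rowScanProg_provide_const K' B l₀ hB G₁ (hl.trans hGG₁.length_le) hG₁
    (if e.1 = e.2 then 1 else 0)
  rwa [show MvPolynomial.C (if e.1 = e.2 then (1 : ℂ) else 0) =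
      (1 : Matrix (Fin w) (Fin w) (MvPolynomial (Fin n × Fin n) ℂ)) e.1 e.2 by
    rw [Matrix.one_apply]; split_ifs <;> simp] at h

/-- **One step of Newton's recursion.** If the entries of `E_{m'}` (`m' < m`) and of the
`P_{i+1}` (`i < n`) are provided at support `∅`, then `m w³` product gates
`(E_{m-1-i})_{ac} (P_{i+1})_{cb}` and `w²` weighted sum gates (coefficients `(-1)^i / m`, fan-in
`m w + 1`) provide the entries of `E_m`. [folklore] -/
theorem rowScanProg_blockEstep {n w : ℕ} (K' : ℕ → Finset (Fin n)) (B l₀ : ℕ)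
    (hK' : ∀ j, l₀ ≤ j → K' j = ∅) (hB : n * w + 1 ≤ B)
    (E Pm : ℕ → Matrix (Fin w) (Fin w) (MvPolynomial (Fin n × Fin n) ℂ)) (m : ℕ)
    (hmn : m ≤ n)
    (hE : ∀ a b, E m a b = ∑ ic : Fin m × Fin w,
      ((-1 : ℂ) ^ (ic.1 : ℕ) / (m : ℂ)) • (E (m - 1 - ic.1) a ic.2 * Pm ic.1 ic.2 b))
    (G : List (ArithCircuit.Gate ℂ (Fin n × Fin n))) (hl : l₀ ≤ G.length)
    (hG : (∀ g ∈ G, g.args ≠ []) ∧ (∀ g ∈ G, g.fanIn ≤ B) ∧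
      (∀ (i : ℕ) (g : ArithCircuit.Gate ℂ (Fin n × Fin n)), G[i]? = some g →
        ∀ u ∈ g.args, u.RefsBelow i) ∧
      (∀ (i : ℕ) (us : List (ArithCircuit.Operand ℂ (Fin n × Fin n))),
        G[i]? = some (.prod us) → ∀ u ∈ us, SupportSymm.osupp K' u ⊆ K' i) ∧
      (∀ (i : ℕ) (σ : Equiv.Perm (Fin n)), i < G.length → (∀ x ∈ K' i, σ x = x) →
        MvPolynomial.rename (fun pq : Fin n × Fin n => (σ pq.1, σ pq.2))
          ((ArithCircuit.gateValues G).getD i 0) = (ArithCircuit.gateValues G).getD i 0))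
    (hEprov : ∀ m' < m, ∀ a c : Fin w, ∃ j, l₀ ≤ j ∧ j < G.length ∧
      (ArithCircuit.gateValues G).getD j 0 = E m' a c)
    (hPprov : ∀ i < n, ∀ c b : Fin w, ∃ j, l₀ ≤ j ∧ j < G.length ∧
      (ArithCircuit.gateValues G).getD j 0 = Pm i c b) :
    ∃ G' : List (ArithCircuit.Gate ℂ (Fin n × Fin n)), G <+: G' ∧
      ((∀ g ∈ G', g.args ≠ []) ∧ (∀ g ∈ G', g.fanIn ≤ B) ∧
        (∀ (i : ℕ) (g : ArithCircuit.Gate ℂ (Fin n × Fin n)), G'[i]? = some g →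
          ∀ u ∈ g.args, u.RefsBelow i) ∧
        (∀ (i : ℕ) (us : List (ArithCircuit.Operand ℂ (Fin n × Fin n))),
          G'[i]? = some (.prod us) → ∀ u ∈ us, SupportSymm.osupp K' u ⊆ K' i) ∧
        (∀ (i : ℕ) (σ : Equiv.Perm (Fin n)), i < G'.length → (∀ x ∈ K' i, σ x = x) →
          MvPolynomial.rename (fun pq : Fin n × Fin n => (σ pq.1, σ pq.2))
            ((ArithCircuit.gateValues G').getD i 0) = (ArithCircuit.gateValues G').getD i 0)) ∧
      G'.length ≤ G.length +
        (Fintype.card (Fin m × Fin w × Fin w × Fin w) + Fintype.card (Fin w × Fin w)) ∧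
      ∀ e : Fin w × Fin w, ∃ j, l₀ ≤ j ∧ j < G'.length ∧
        (ArithCircuit.gateValues G').getD j 0 = E m e.1 e.2 := by
  -- the products `(E_{m-1-i})_{ac} (P_{i+1})_{cb}`
  obtain ⟨G₁, h1, h2, h3, h4⟩ := rowScanProg_provide_all K' B l₀
    (fun e : Fin m × Fin w × Fin w × Fin w =>
      E (m - 1 - e.1) e.2.1 e.2.2.1 * Pm e.1 e.2.2.1 e.2.2.2)
    G hG (fun G₁ hGG₁ hG₁ e => rowScanProg_provide_prod K' B l₀ hK'
      (by nlinarith [Nat.mul_le_mul (Nat.zero_lt_of_lt (lt_of_lt_of_le e.1.2 hmn)) e.2.1.pos])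
      G₁ (hl.trans hGG₁.length_le) hG₁
      (rowScanProg_prov_mono hGG₁ (hEprov _ (by omega) _ _))
      (rowScanProg_prov_mono hGG₁ (hPprov _ (lt_of_lt_of_le e.1.2 hmn) _ _)))
  -- the weighted sums
  have hcard : Fintype.card (Fin m × Fin w) + 1 ≤ B := by
    have : m * w ≤ n * w := Nat.mul_le_mul_right w hmn
    simp only [Fintype.card_prod, Fintype.card_fin]
    omega
  obtain ⟨G₂, k1, k2, k3, k4⟩ := rowScanProg_provide_all K' B l₀
    (fun e : Fin w × Fin w => E m e.1 e.2) G₁ h2 (fun G'' hG'' hI'' e => by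
      have h := rowScanProg_provide_wsum K' B l₀ hK' hcard
        (fun ic : Fin m × Fin w => (-1 : ℂ) ^ (ic.1 : ℕ) / (m : ℂ))
        (fun ic : Fin m × Fin w => E (m - 1 - ic.1) e.1 ic.2 * Pm ic.1 ic.2 e.2) G''
        ((hl.trans h1.length_le).trans hG''.length_le) hI''
        (fun ic => rowScanProg_prov_mono hG'' (h4 (ic.1, e.1, ic.2, e.2)))
      rwa [← hE] at h)
  exact ⟨G₂, h1.trans k1, k2, by omega, k4⟩

/-- **Newton's recursion, all steps.** From the entries of `E_0` and of the `P_{i+1}` (`i < n`),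
`k` steps provide the entries of `E_0, …, E_k` (`k ≤ n`) with at most `k (n w³ + w²)` gates.
[folklore] -/
theorem rowScanProg_blockE {n w : ℕ} (K' : ℕ → Finset (Fin n)) (B l₀ : ℕ)
    (hK' : ∀ j, l₀ ≤ j → K' j = ∅) (hB : n * w + 1 ≤ B)
    (E Pm : ℕ → Matrix (Fin w) (Fin w) (MvPolynomial (Fin n × Fin n) ℂ))
    (hE : ∀ m, 1 ≤ m → m ≤ n → ∀ a b, E m a b = ∑ ic : Fin m × Fin w,
      ((-1 : ℂ) ^ (ic.1 : ℕ) / (m : ℂ)) • (E (m - 1 - ic.1) a ic.2 * Pm ic.1 ic.2 b))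
    (G : List (ArithCircuit.Gate ℂ (Fin n × Fin n))) (hl : l₀ ≤ G.length)
    (hG : (∀ g ∈ G, g.args ≠ []) ∧ (∀ g ∈ G, g.fanIn ≤ B) ∧
      (∀ (i : ℕ) (g : ArithCircuit.Gate ℂ (Fin n × Fin n)), G[i]? = some g →
        ∀ u ∈ g.args, u.RefsBelow i) ∧
      (∀ (i : ℕ) (us : List (ArithCircuit.Operand ℂ (Fin n × Fin n))),
        G[i]? = some (.prod us) → ∀ u ∈ us, SupportSymm.osupp K' u ⊆ K' i) ∧
      (∀ (i : ℕ) (σ : Equiv.Perm (Fin n)), i < G.length → (∀ x ∈ K' i, σ x = x) →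
        MvPolynomial.rename (fun pq : Fin n × Fin n => (σ pq.1, σ pq.2))
          ((ArithCircuit.gateValues G).getD i 0) = (ArithCircuit.gateValues G).getD i 0))
    (hE0 : ∀ a b : Fin w, ∃ j, l₀ ≤ j ∧ j < G.length ∧
      (ArithCircuit.gateValues G).getD j 0 = E 0 a b)
    (hP : ∀ i < n, ∀ c b : Fin w, ∃ j, l₀ ≤ j ∧ j < G.length ∧
      (ArithCircuit.gateValues G).getD j 0 = Pm i c b) :
    ∀ k ≤ n, ∃ G' : List (ArithCircuit.Gate ℂ (Fin n × Fin n)), G <+: G' ∧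
      ((∀ g ∈ G', g.args ≠ []) ∧ (∀ g ∈ G', g.fanIn ≤ B) ∧
        (∀ (i : ℕ) (g : ArithCircuit.Gate ℂ (Fin n × Fin n)), G'[i]? = some g →
          ∀ u ∈ g.args, u.RefsBelow i) ∧
        (∀ (i : ℕ) (us : List (ArithCircuit.Operand ℂ (Fin n × Fin n))),
          G'[i]? = some (.prod us) → ∀ u ∈ us, SupportSymm.osupp K' u ⊆ K' i) ∧
        (∀ (i : ℕ) (σ : Equiv.Perm (Fin n)), i < G'.length → (∀ x ∈ K' i, σ x = x) →
          MvPolynomial.rename (fun pq : Fin n × Fin n => (σ pq.1, σ pq.2))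
            ((ArithCircuit.gateValues G').getD i 0) = (ArithCircuit.gateValues G').getD i 0)) ∧
      G'.length ≤ G.length + k * (n * (w * (w * w)) + w * w) ∧
      ∀ m ≤ k, ∀ a b : Fin w, ∃ j, l₀ ≤ j ∧ j < G'.length ∧
        (ArithCircuit.gateValues G').getD j 0 = E m a b := by
  intro k
  induction k with
  | zero =>
    intro _
    exact ⟨G, List.prefix_rfl, hG, by simp, fun m hm a b => by
      obtain rfl := Nat.le_zero.mp hm
      exact hE0 a b⟩
  | succ k ih =>
    intro hk
    obtain ⟨G₁, h1, h2, h3, h4⟩ := ih (Nat.le_of_succ_le hk)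
    obtain ⟨G₂, k1, k2, k3, k4⟩ := rowScanProg_blockEstep K' B l₀ hK' hB E Pm (k + 1) hk
      (hE (k + 1) (Nat.succ_pos k) hk) G₁ (hl.trans h1.length_le) h2
      (fun m' hm' a c => h4 m' (Nat.lt_succ_iff.mp hm') a c)
      (fun i hi c b => rowScanProg_prov_mono h1 (hP i hi c b))
    refine ⟨G₂, h1.trans k1, k2, ?_, fun m hm a b => ?_⟩
    · simp only [Fintype.card_prod, Fintype.card_fin] at k3
      have : (k + 1) * (w * (w * w)) ≤ n * (w * (w * w)) := Nat.mul_le_mul_right _ hk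
      rw [Nat.succ_mul]
      omega
    · rcases Nat.lt_or_eq_of_le hm with hm | rfl
      · exact rowScanProg_prov_mono k1 (h4 m (Nat.lt_succ_iff.mp hm) a b)
      · exact k4 (a, b)

end Summit.ValiantsHypothesis.ValiantsHypothesis.Theorems

end
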